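import Summits.QuantumFields.YangMills.Theorems.PencilRigidityWeakCouplingHypercubicLimitDecayOfRPSpectral
import HarnessLib

/-!
# `ContinuumFromLatticeGap` (stmt-QuantumFields-15915), line `registered`, reshape 5 — toolkit: slab-BOX support of plane
# fields and of the smeared plane-string functional (the LOCAL RP-spectral class)

Support file for the crux item stmt-QuantumFields-15915 (`GronwallGap.ContinuumFromLatticeGap`).  Reshape 5 of line
`registered` replaces the physically over-quantified RP-spectral conjunct (b) of `IRInputs` / W₁ (relative clustering of
ALL bounded measurable time-slab functionals, spatially GLOBAL — refuted at every light-flux group modulo `LightFluxMode`,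
`Theorems/GapAtCorrelationLength/Negative/*`, `Theorems/ContinuumFromLatticeGap/Negative/*`) by its LOCAL form: the same
inequality for slab functionals `Y` depending only on edges `e` with `1 ≤ e⁰`, `e⁰ + [μ = 0] ≤ T₀` AND `|eⁱ| ≤ R` (`i ≠ 0`)
on tori `2S₀+1` with `2(R+1) ≤ S₀`.  This toolkit file supplies the support facts the re-proof of the ONLY consumer of (b)
(`stub_decayOfRPSpectral` ↦ `stub_decayOfRPSpectralLocal`, next file) needs: a plane field at a base site in the time
slab `[1, T]` and the spatial box `|xⁱ| + 1 ≤ R` depends only on the slab-box edges (`plane_congr_of_slabBox`), hence so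
does the smeared plane-string functional of a test function whose lattice support obeys both constraints
(`curvFunctional_dependsOn_slabBox`).  No definitions, no named facts.  Refs: OsterwalderSeiler1978 §2.
-/

noncomputable section

open scoped SchwartzMap BigOperators ComplexConjugate
open MeasureTheory Filter Topology
open Literature.MathematicalPhysics.QuantumFieldTheory Literature.MathematicalPhysics.QuantumLattice
open Literature.MathematicalPhysics.AQFT
open Literature.Probability.LatticeModels (box Site mem_box)
open Summit.QuantumFields.YangMills.Cruxes.HypercubicLimit.CouplingResponse
open Summit.QuantumFields.YangMills.Cruxes.OSLegsFromFemtoAndGap.DlrCollarTransfer (plane conn Decay RPPos ConnCS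
  isCylinder_plane near_of_mem_supp_plane)
open Summit.QuantumFields.YangMills.Cruxes.OSLegsAtWeakCouplingC.Sketch (Separated)
open Summit.QuantumFields.YangMills.Theorems.OSLegsFromFemtoAndGap
open Summit.QuantumFields.YangMills.Theorems.WeakCouplingHypercubicLimit.TraceNormColdPressure

namespace Summit.QuantumFields.YangMills.Theorems.ContinuumFromLatticeGap

variable {G : Type} [Group G] [TopologicalSpace G] [IsTopologicalGroup G] [CompactSpace G]
  [MeasurableSpace G] [BorelSpace G]

/-! ### Support of plane fields and of the smeared functional in the LOCAL class -/

omit [IsTopologicalGroup G] [CompactSpace G] [BorelSpace G] in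
/-- **Slab-box support of a plane field**: for a valid orientation, a base site `x` with `1 ≤ x⁰`, `x⁰ + 1 ≤ T` and
`|xⁱ| + 1 ≤ R` (`i ≠ 0`), the plane field at `x` agrees on two configurations that agree on the edges of the time slab
`[1, T]` lying in the spatial box of half-side `R` (its four links are based at `x`, `x + eᵢ`, `x + eⱼ`). [folklore] -/
theorem plane_congr_of_slabBox (r : LatticeRep G) {q : Fin 4 × Fin 4} (hq : q.1 < q.2) {x : Site 4} {T R : ℕ}
    (hx1 : 1 ≤ x 0) (hxT : x 0 + 1 ≤ T) (hxR : ∀ i : Fin 4, i ≠ 0 → |x i| + 1 ≤ R) {U V : LGConfig 4 G}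
    (hUV : ∀ e ∈ {e : Literature.MathematicalPhysics.QuantumLattice.ZdEdge 4 |
      (1 ≤ e.1 0 ∧ e.1 0 + (if e.2 = 0 then 1 else 0) ≤ T) ∧ ∀ i : Fin 4, i ≠ 0 → |e.1 i| ≤ R}, U e = V e) :
    plane G r q x U = plane G r q x V := by
  have hj : q.2 ≠ 0 := fun h => by rw [h] at hq; exact absurd hq (Fin.not_lt.2 (Fin.zero_le _))
  refine isCylinder_plane r q x (fun e he => hUV e ⟨?_, fun i hi => ?_⟩)
  · obtain ⟨e', he', rfl⟩ := Finset.mem_image.1 (Finset.mem_coe.1 he)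
    simp only [originPlaquetteSupport, Finset.mem_insert, Finset.mem_singleton] at he'
    simp only [sub_neg_eq_add, Pi.add_apply]
    rcases he' with rfl | rfl | rfl | rfl
    · simp only [Pi.zero_apply, zero_add]
      split_ifs <;> omega
    · simp only [Pi.single_apply, if_neg hj, add_zero]
      split_ifs <;> omega
    · simp only [Pi.single_apply, if_neg hj.symm]
      split_ifs <;> omega
    · simp only [Pi.zero_apply, zero_add, if_neg hj, add_zero]
      omega
  · have h := near_of_mem_supp_plane (Finset.mem_coe.1 he) i
    have hx := hxR i hi
    have h1 := le_abs_self (x i)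
    have h2 := neg_abs_le (x i)
    rw [abs_le]
    constructor <;> omega

omit [IsTopologicalGroup G] [CompactSpace G] [BorelSpace G] in
/-- **Slab-box dependence of the smeared plane-string functional**: if `F(a y) ≠ 0` forces every point of the
multi-site `y` into the time slab `1 ≤ y_l⁰`, `y_l⁰ + 1 ≤ T` and the spatial box `|y_lⁱ| + 1 ≤ R`, then
`Y V = Re Σ_q Σ_y F(a y) ∏ₗ (plane (q l) (y l) V − m (q l))` depends only on the slab-box edges. [folklore] -/
theorem curvFunctional_dependsOn_slabBox (r : LatticeRep G) (L : ℕ) (a : ℝ) (n : ℕ)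
    (F : 𝓢((Fin n → EuclideanSpace ℝ (Fin 4)), ℂ)) (m : Fin 4 × Fin 4 → ℝ) (T R : ℕ)
    (hT : ∀ y : Fin n → Site 4, F (fun l => a • siteToE (y l)) ≠ 0 → ∀ l, 1 ≤ y l 0 ∧ y l 0 + 1 ≤ T)
    (hR : ∀ y : Fin n → Site 4, F (fun l => a • siteToE (y l)) ≠ 0 → ∀ l, ∀ i : Fin 4, i ≠ 0 → |y l i| + 1 ≤ R) :
    DependsOn (fun V : LGConfig 4 G =>
      (∑ q ∈ Fintype.piFinset (fun _ : Fin n => Finset.univ.filter fun p : Fin 4 × Fin 4 => p.1 < p.2),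
        ∑ y ∈ Fintype.piFinset (fun _ : Fin n => box 4 L),
          F (fun l => a • siteToE (y l)) * ((∏ l, (plane G r (q l) (y l) V - m (q l)) : ℝ) : ℂ)).re)
      {e : Literature.MathematicalPhysics.QuantumLattice.ZdEdge 4 |
        (1 ≤ e.1 0 ∧ e.1 0 + (if e.2 = 0 then 1 else 0) ≤ T) ∧ ∀ i : Fin 4, i ≠ 0 → |e.1 i| ≤ R} := by
  intro U V hUV
  refine congrArg Complex.re (Finset.sum_congr rfl fun q hq => Finset.sum_congr rfl fun y _ => ?_)
  by_cases h0 : F (fun l => a • siteToE (y l)) = 0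
  · rw [h0, zero_mul, zero_mul]
  · have hq' : ∀ l, (q l).1 < (q l).2 := by simpa [Fintype.mem_piFinset] using hq
    congr 2
    exact Finset.prod_congr rfl fun l _ => by
      rw [plane_congr_of_slabBox r (hq' l) (hT y h0 l).1 (hT y h0 l).2 (hR y h0 l) hUV]


/-- **`stub_slabBoxSupport`** (registered anchor of line `registered`, reshape 5 — the toolkit step of the LOCAL decay
leg, closed form of `curvFunctional_dependsOn_slabBox`): if `F(a y) ≠ 0` forces every point of the multi-site `y` into the
time slab `1 ≤ y_l⁰`, `y_l⁰ + 1 ≤ T` and the spatial box `|y_lⁱ| + 1 ≤ R` (`i ≠ 0`), the smeared plane-string functional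
depends only on the slab-box edges. [folklore] -/
theorem stub_slabBoxSupport :
    ∀ (G : Type) [Group G] [TopologicalSpace G] [MeasurableSpace G] (r : LatticeRep G) (L : ℕ) (a : ℝ) (n : ℕ)
      (F : 𝓢((Fin n → EuclideanSpace ℝ (Fin 4)), ℂ)) (m : Fin 4 × Fin 4 → ℝ) (T R : ℕ),
      (∀ y : Fin n → Site 4, F (fun l => a • siteToE (y l)) ≠ 0 → ∀ l, 1 ≤ y l 0 ∧ y l 0 + 1 ≤ T) →
      (∀ y : Fin n → Site 4, F (fun l => a • siteToE (y l)) ≠ 0 → ∀ l, ∀ i : Fin 4, i ≠ 0 → |y l i| + 1 ≤ R) →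
      DependsOn (fun V : LGConfig 4 G =>
        (∑ q ∈ Fintype.piFinset (fun _ : Fin n => Finset.univ.filter fun p : Fin 4 × Fin 4 => p.1 < p.2),
          ∑ y ∈ Fintype.piFinset (fun _ : Fin n => box 4 L),
            F (fun l => a • siteToE (y l)) * ((∏ l, (plane G r (q l) (y l) V - m (q l)) : ℝ) : ℂ)).re)
        {e : Literature.MathematicalPhysics.QuantumLattice.ZdEdge 4 |
          (1 ≤ e.1 0 ∧ e.1 0 + (if e.2 = 0 then 1 else 0) ≤ T) ∧ ∀ i : Fin 4, i ≠ 0 → |e.1 i| ≤ R} :=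
  fun _ _ _ _ r L a n F m T R hT hR => curvFunctional_dependsOn_slabBox r L a n F m T R hT hR

end Summit.QuantumFields.YangMills.Theorems.ContinuumFromLatticeGap

end
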